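import Summits.Langlands.Langlands.Theorems.SqrtFiveQuarticCoversBorelThreeHauptmodul
import Summits.Langlands.Langlands.Theorems.SqrtFiveQuarticCoversSplitCartanThreeDivisionPolynomial

/-!
# Route `SqrtFiveQuarticCovers` (crux `RefinedLocusModular`, stmt-Langlands-17833): the hauptmodul of
# `X_s⁺(3)` — an `s3`-framing gives `u ∈ K` with `c₄³ u³ = 27 (u+1)³ (u−3)³ Δ` (off `j ∈ {0, 1728}`)

Third level-`3` brick (after p798920/p799099 for `b3` and p799791 for `s3`).  RECORD v5's MODEL input
`hNFw` (certificate `CertS3H12`, `Theorems/SqrtFiveQuarticCoversRecordWeak5.lean`) concludes, from an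
`s3 ∧ H12` framing, `c₄ = 0 ∨ c₄³ = 8000Δ ∨ ∃ u t w, c₄³·u³ = 27(u+1)³(u−3)³·Δ ∧ (level-5 equations)`:
its LEVEL-`3` conjunct is the uniformisation `j = 27(u+1)³(u−3)³/u³` of `X_s⁺(3) → X(1)` (FLS 2015
§2.2; Zywina).  This file PROVES that conjunct from the `s3`-binder alone, with the honest exceptional
set `j ∈ {0, 1728}` (`c₄ = 0 ∨ c₄³ = 1728Δ`), where distinct `3`-subgroups may give the same point of
`X₀(3)`.

Method (all certificates are small `linear_combination`s):
* the two `3`-subgroups of the `s3`-structure give DISTINCT roots `x₀ ≠ x₁` of `Ψ₃` with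
  `x₀ + x₁, x₀x₁ ∈ K` (p799791); each root has its flex data `τᵢ, υᵢ` with `Δ = τᵢ³ − 27υᵢ²`,
  `c₄υᵢ² = τᵢ(τᵢ³ − 24υᵢ²)` (p799099) and its `X₀(3)`-coordinate `tᵢ = Δ/υᵢ²`,
  `c₄³ tᵢ = (tᵢ+27)(tᵢ+3)³ Δ`;
* if `t₀ ≠ t₁`: Vieta on the pair of roots of `Φ(T) = (T+27)(T+3)³Δ − c₄³T` gives, with `A = t₀+t₁`,
  `B = t₀t₁`: `c₄³ = Δ·(A³ + 36A² + 270A + 756 − 2AB − 36B)` and `B(A² + 36A + 270 − B) = 729`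
  (`pair_relations_of_roots`); then `u = 9(A+18)/(B+27)` satisfies `c₄³u³ = 27(u+1)³(u−3)³Δ`
  (`pair_hauptmodul_identity`, a degree-`9` identity with an explicit cofactor), unless `B = −27`,
  which forces `A = −18` and `j = 1728`;
* if `t₀ = t₁` (`υ₀² = υ₁²`): `τ₀³ = τ₁³`; either `τ₀ = τ₁`, then `6(x₀+x₁) + b₂ = 0` and the pair
  relation `r₁ = 0` give `c₆ = 0`, i.e. `c₄³ = 1728Δ`; or `τ₀ ≠ τ₁`, then `c₄ = 0`;
* descent: `A, B` (hence `u`) are symmetric in `(x₀, x₁)`, written through `x₀+x₁`, `x₀x₁ ∈ K`.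

Main statements: `exists_XsplitThree_hauptmodul_of_pair_roots` (any field extension `L/K`, explicit
pair of roots) and `exists_XsplitThree_hauptmodul_of_splitCartanThree_framing` (number field, the
cruxes' `s3`-binder VERBATIM ⇒ `c₄ = 0 ∨ c₄³ = 1728Δ ∨ ∃ u : K, c₄³u³ = 27(u+1)³(u−3)³Δ`).
Everything is proved; no named fact.  HONEST STATUS: helper of stmt-Langlands-17833 (N1 debt); it does
not move the binder `hNFw` (whose level-`3` and level-`5` data are bundled and whose exceptional set is
`{0, 8000}`); closes no stub; nothing here proves modularity of any curve.

References: R. Fricke, *Die elliptischen Funktionen und ihre Anwendungen* II (1922); D. Zywina, *On the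
possible images of the mod ℓ representations associated to elliptic curves over ℚ*, arXiv:1508.07660,
§1.1 (`X_{Nsp}(3)`); [FreitasLeHungSiksek2015] §2.2; J. H. Silverman, GTM 106, III.§1, Ex. 3.7.
-/

noncomputable section

set_option linter.dupNamespace false -- project-wide option (lakefile weak.linter.dupNamespace); `Summit.Langlands.Langlands` is the mandated namespace

open scoped Classical
open scoped Matrix NumberField

namespace Summit.Langlands.Langlands.Theorems.SqrtFiveQuarticCovers

open WeierstrassCurve Literature.NumberTheory.GaloisRepresentations Polynomial

/-- **Vieta for a pair of distinct roots of `Φ(T) = (T+27)(T+3)³Δ − cT`.**  Over a field with `Δ ≠ 0`,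
two distinct roots `t₀ ≠ t₁` of `Φ` satisfy, with `A = t₀ + t₁`, `B = t₀ t₁`:
`c = Δ (A³ + 36A² + 270A + 756 − 2AB − 36B)` and `B (A² + 36A + 270 − B) = 729` (the coefficients of
`Φ/Δ = (T² − AT + B)(T² + (A+36)T + (A²+36A+270−B))`). [folklore] -/
theorem pair_relations_of_roots {L : Type*} [Field L] {c Δ t₀ t₁ : L} (hΔ : Δ ≠ 0) (hne : t₀ ≠ t₁)
    (h₀ : c * t₀ = (t₀ + 27) * (t₀ + 3) ^ 3 * Δ) (h₁ : c * t₁ = (t₁ + 27) * (t₁ + 3) ^ 3 * Δ) :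
    c = Δ * ((t₀ + t₁) ^ 3 + 36 * (t₀ + t₁) ^ 2 + 270 * (t₀ + t₁) + 756
        - 2 * (t₀ + t₁) * (t₀ * t₁) - 36 * (t₀ * t₁)) ∧
      (t₀ * t₁) * ((t₀ + t₁) ^ 2 + 36 * (t₀ + t₁) + 270 - t₀ * t₁) = 729 := by
  have hsub : t₀ - t₁ ≠ 0 := sub_ne_zero.2 hne
  have hc : c = Δ * ((t₀ + t₁) ^ 3 + 36 * (t₀ + t₁) ^ 2 + 270 * (t₀ + t₁) + 756
      - 2 * (t₀ + t₁) * (t₀ * t₁) - 36 * (t₀ * t₁)) := by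
    have key : (t₀ - t₁) * (Δ * ((t₀ + t₁) ^ 3 + 36 * (t₀ + t₁) ^ 2 + 270 * (t₀ + t₁) + 756
        - 2 * (t₀ + t₁) * (t₀ * t₁) - 36 * (t₀ * t₁)) - c) = 0 := by
      linear_combination (-1 : L) * h₀ + h₁
    have := (mul_eq_zero.1 key).resolve_left hsub
    linear_combination -this
  refine ⟨hc, ?_⟩
  have key : Δ * ((t₀ * t₁) * ((t₀ + t₁) ^ 2 + 36 * (t₀ + t₁) + 270 - t₀ * t₁) - 729) = 0 := by
    linear_combination h₀ - t₀ * hc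
  have := (mul_eq_zero.1 key).resolve_left hΔ
  linear_combination this

/-- **The `X_s⁺(3)` hauptmodul identity at the level of the pair `(A, B)`.**  If
`c = Δ·(A³ + 36A² + 270A + 756 − 2AB − 36B)` and `B(A² + 36A + 270 − B) = 729`, then
`c · (9(A+18))³ · (B+27)³ = 27 · (9(A+18) + (B+27))³ · (9(A+18) − 3(B+27))³ · Δ` — i.e.
`u = 9(A+18)/(B+27)` satisfies `c u³ = 27(u+1)³(u−3)³ Δ`; explicit degree-`6` cofactor. [folklore] -/
theorem pair_hauptmodul_identity {L : Type*} [CommRing L] {c Δ A B : L}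
    (hc : c = Δ * (A ^ 3 + 36 * A ^ 2 + 270 * A + 756 - 2 * A * B - 36 * B))
    (hrel : B * (A ^ 2 + 36 * A + 270 - B) = 729) :
    c * (9 * (A + 18)) ^ 3 * (B + 27) ^ 3 =
      27 * (9 * (A + 18) + (B + 27)) ^ 3 * (9 * (A + 18) - 3 * (B + 27)) ^ 3 * Δ := by
  linear_combination ((9 * (A + 18)) ^ 3 * (B + 27) ^ 3) * hc
    + (Δ * ((729) * A ^ 4 * B ^ 2 + (-729) * A ^ 2 * B ^ 3 + (39366) * A ^ 3 * B ^ 2 + (59049) * A ^ 4 * B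
        + (-729) * B ^ 4 + (-39366) * A * B ^ 3 + (649539) * A ^ 2 * B ^ 2 + (3188646) * A ^ 3 * B
        + (1594323) * A ^ 4 + (-551124) * B ^ 3 + (1062882) * A * B ^ 2 + (55801305) * A ^ 2 * B
        + (95659380) * A ^ 3 + (-41452398) * B ^ 2 + (258280326) * A * B + (2051893701) * A ^ 2
        + (-1090516932) * B + (17821342494) * A + (46103038191))) * hrel

/-- Passing from the cleared identity to the hauptmodul `u = 9(A+18)/(B+27)` (`B ≠ −27`). [folklore] -/
theorem pair_hauptmodul_div {L : Type*} [Field L] {c Δ A B : L} (hB : B + 27 ≠ 0)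
    (h : c * (9 * (A + 18)) ^ 3 * (B + 27) ^ 3 =
      27 * (9 * (A + 18) + (B + 27)) ^ 3 * (9 * (A + 18) - 3 * (B + 27)) ^ 3 * Δ) :
    c * (9 * (A + 18) / (B + 27)) ^ 3 =
      27 * (9 * (A + 18) / (B + 27) + 1) ^ 3 * (9 * (A + 18) / (B + 27) - 3) ^ 3 * Δ := by
  set u := 9 * (A + 18) / (B + 27) with hu
  have hu' : 9 * (A + 18) = u * (B + 27) := by rw [hu, div_mul_cancel₀ _ hB]
  have key : (B + 27) ^ 6 * (c * u ^ 3 - 27 * (u + 1) ^ 3 * (u - 3) ^ 3 * Δ) = 0 := by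
    rw [hu'] at h
    linear_combination h
  have hB6 : (B + 27) ^ 6 ≠ 0 := pow_ne_zero 6 hB
  have := (mul_eq_zero.1 key).resolve_left hB6
  linear_combination this

/-- **The hauptmodul of `X_s⁺(3)` from a `K`-rational pair of roots of `Ψ₃`.**  Let `L/K` be a field
extension, `V` a Weierstrass curve over `K` with `Δ(V) ≠ 0`, and `x₀ ≠ x₁` roots in `L` of `Ψ₃(V)` with
`x₀ + x₁ = s ∈ K`, `x₀x₁ = p ∈ K`.  Then `c₄(V) = 0` (`j = 0`), or `c₄(V)³ = 1728 Δ(V)` (`j = 1728`), or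
there is `u ∈ K` with `c₄(V)³ · u³ = 27 (u+1)³ (u−3)³ · Δ(V)` — `j(V) = 27(u+1)³(u−3)³/u³` is the image
of a `K`-point of `X_s⁺(3)`.  See the module docstring for the proof (flex data at both roots, Vieta on
the pair of `X₀(3)`-coordinates, the coincidence cases, symmetric descent).
[cite: FreitasLeHungSiksek2015, §2.2] [cite: SilvermanAEC2009, III.§1, Ex. 3.7] -/
theorem exists_XsplitThree_hauptmodul_of_pair_roots {K L : Type*} [Field K] [Field L] [CharZero L]
    [Algebra K L] (V : WeierstrassCurve K) (hΔ : V.Δ ≠ 0) {x₀ x₁ : L} (hne : x₀ ≠ x₁)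
    (hx₀ : (V.baseChange L).Ψ₃.eval x₀ = 0) (hx₁ : (V.baseChange L).Ψ₃.eval x₁ = 0)
    {s p : K} (hs : x₀ + x₁ = algebraMap K L s) (hp : x₀ * x₁ = algebraMap K L p) :
    V.c₄ = 0 ∨ V.c₄ ^ 3 = 1728 * V.Δ ∨
      ∃ u : K, V.c₄ ^ 3 * u ^ 3 = 27 * (u + 1) ^ 3 * (u - 3) ^ 3 * V.Δ := by
  have inj : Function.Injective (algebraMap K L) := (algebraMap K L).injective
  -- the invariants of `W = V ⊗ L` are the images of those of `V`
  have hb₂ : (V.baseChange L).b₂ = algebraMap K L V.b₂ := by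
    rw [WeierstrassCurve.baseChange, WeierstrassCurve.map_b₂]
  have hb₄ : (V.baseChange L).b₄ = algebraMap K L V.b₄ := by
    rw [WeierstrassCurve.baseChange, WeierstrassCurve.map_b₄]
  have hb₆ : (V.baseChange L).b₆ = algebraMap K L V.b₆ := by
    rw [WeierstrassCurve.baseChange, WeierstrassCurve.map_b₆]
  have hc₄ : (V.baseChange L).c₄ = algebraMap K L V.c₄ := by
    rw [WeierstrassCurve.baseChange, WeierstrassCurve.map_c₄]
  have hc₆ : (V.baseChange L).c₆ = algebraMap K L V.c₆ := by
    rw [WeierstrassCurve.baseChange, WeierstrassCurve.map_c₆]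
  have hΔ' : (V.baseChange L).Δ = algebraMap K L V.Δ := by
    rw [WeierstrassCurve.baseChange, WeierstrassCurve.map_Δ]
  have hΔL : (V.baseChange L).Δ ≠ 0 := by
    rw [hΔ']; exact (map_ne_zero_iff _ inj).2 hΔ
  -- flex data at the two roots
  have h1₀ := Δ_eq_of_eval_Ψ₃_eq_zero (V.baseChange L) hx₀
  have h2₀ := c₄_mul_eq_of_eval_Ψ₃_eq_zero (V.baseChange L) hx₀
  have hυ₀ := υ_ne_zero_of_eval_Ψ₃_eq_zero (V.baseChange L) hx₀ hΔL
  have h1₁ := Δ_eq_of_eval_Ψ₃_eq_zero (V.baseChange L) hx₁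
  have h2₁ := c₄_mul_eq_of_eval_Ψ₃_eq_zero (V.baseChange L) hx₁
  have hυ₁ := υ_ne_zero_of_eval_Ψ₃_eq_zero (V.baseChange L) hx₁ hΔL
  -- name the flex data
  obtain ⟨τ₀, hτ₀⟩ : ∃ τ : L, τ = 6 * x₀ ^ 2 + (V.baseChange L).b₂ * x₀ + (V.baseChange L).b₄ := ⟨_, rfl⟩
  obtain ⟨τ₁, hτ₁⟩ : ∃ τ : L, τ = 6 * x₁ ^ 2 + (V.baseChange L).b₂ * x₁ + (V.baseChange L).b₄ := ⟨_, rfl⟩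
  obtain ⟨υ₀, hυ₀d⟩ : ∃ υ : L,
      υ = 4 * x₀ ^ 3 + (V.baseChange L).b₂ * x₀ ^ 2 + 2 * (V.baseChange L).b₄ * x₀ + (V.baseChange L).b₆ :=
    ⟨_, rfl⟩
  obtain ⟨υ₁, hυ₁d⟩ : ∃ υ : L,
      υ = 4 * x₁ ^ 3 + (V.baseChange L).b₂ * x₁ ^ 2 + 2 * (V.baseChange L).b₄ * x₁ + (V.baseChange L).b₆ :=
    ⟨_, rfl⟩
  rw [← hτ₀, ← hυ₀d] at h1₀ h2₀
  rw [← hυ₀d] at hυ₀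
  rw [← hτ₁, ← hυ₁d] at h1₁ h2₁
  rw [← hυ₁d] at hυ₁
  -- the pair relation `r₁ = 0` (the `X`-coefficient of `Ψ₃ mod (X − x₀)(X − x₁)`)
  have hΨ₀ : 3 * x₀ ^ 4 + (V.baseChange L).b₂ * x₀ ^ 3 + 3 * (V.baseChange L).b₄ * x₀ ^ 2
      + 3 * (V.baseChange L).b₆ * x₀ + (V.baseChange L).b₈ = 0 := by
    rw [← eval_Ψ₃_eq]; exact hx₀
  have hΨ₁ : 3 * x₁ ^ 4 + (V.baseChange L).b₂ * x₁ ^ 3 + 3 * (V.baseChange L).b₄ * x₁ ^ 2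
      + 3 * (V.baseChange L).b₆ * x₁ + (V.baseChange L).b₈ = 0 := by
    rw [← eval_Ψ₃_eq]; exact hx₁
  have hr₁ : 3 * (x₀ + x₁) ^ 3 - 6 * (x₀ + x₁) * (x₀ * x₁) + (V.baseChange L).b₂ * ((x₀ + x₁) ^ 2 - x₀ * x₁)
      + 3 * (V.baseChange L).b₄ * (x₀ + x₁) + 3 * (V.baseChange L).b₆ = 0 := by
    have key : (x₀ - x₁) * (3 * (x₀ + x₁) ^ 3 - 6 * (x₀ + x₁) * (x₀ * x₁)
        + (V.baseChange L).b₂ * ((x₀ + x₁) ^ 2 - x₀ * x₁) + 3 * (V.baseChange L).b₄ * (x₀ + x₁)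
        + 3 * (V.baseChange L).b₆)
        = (3 * x₀ ^ 4 + (V.baseChange L).b₂ * x₀ ^ 3 + 3 * (V.baseChange L).b₄ * x₀ ^ 2
            + 3 * (V.baseChange L).b₆ * x₀ + (V.baseChange L).b₈)
          - (3 * x₁ ^ 4 + (V.baseChange L).b₂ * x₁ ^ 3 + 3 * (V.baseChange L).b₄ * x₁ ^ 2
            + 3 * (V.baseChange L).b₆ * x₁ + (V.baseChange L).b₈) := by ring
    rw [hΨ₀, hΨ₁, sub_zero] at key
    exact (mul_eq_zero.1 key).resolve_left (sub_ne_zero.2 hne)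
  -- pull-backs of the three possible conclusions
  have back0 : (V.baseChange L).c₄ = 0 → V.c₄ = 0 := fun h => by
    apply inj; rw [← hc₄, h, map_zero]
  have back1728 : (V.baseChange L).c₄ ^ 3 = 1728 * (V.baseChange L).Δ → V.c₄ ^ 3 = 1728 * V.Δ :=
      fun h => by
    apply inj
    rw [map_pow, map_mul, map_ofNat, ← hc₄, ← hΔ', h]
  by_cases hU : υ₀ ^ 2 = υ₁ ^ 2
  · -- coincidence `t₀ = t₁`: `τ₀³ = τ₁³`
    have h3 : τ₀ ^ 3 = τ₁ ^ 3 := by linear_combination (-1 : L) * h1₀ + h1₁ + 27 * hU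
    by_cases hτ : τ₀ = τ₁
    · -- `τ₀ = τ₁`: `6(x₀+x₁) + b₂ = 0`, then `c₆ = 0`, i.e. `j = 1728`
      have hm : (V.baseChange L).b₂ + 6 * (x₀ + x₁) = 0 := by
        have key : (x₀ - x₁) * ((V.baseChange L).b₂ + 6 * (x₀ + x₁)) = τ₀ - τ₁ := by
          rw [hτ₀, hτ₁]; ring
        rw [hτ, sub_self] at key
        exact (mul_eq_zero.1 key).resolve_left (sub_ne_zero.2 hne)
      have hc₆0 : (V.baseChange L).c₆ = 0 := by
        rw [WeierstrassCurve.c₆]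
        linear_combination (-72 : L) * hr₁
          + (-((V.baseChange L).b₂ ^ 2) + 6 * (x₀ + x₁) * (V.baseChange L).b₂ + 36 * (x₀ + x₁) ^ 2
              + 36 * (V.baseChange L).b₄ - 72 * (x₀ * x₁)) * hm
      right; left
      apply back1728
      have hcr := (V.baseChange L).c_relation
      rw [hc₆0] at hcr
      linear_combination -hcr
    · -- `τ₀ ≠ τ₁`: `c₄ = 0`, i.e. `j = 0`
      left
      apply back0
      have key : (τ₁ - τ₀) * ((V.baseChange L).c₄ * υ₀ ^ 2) = 0 := by
        linear_combination τ₁ * h2₀ - τ₀ * h2₁ + (τ₀ * τ₁) * h3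
          + (-(τ₀ * (V.baseChange L).c₄) - 24 * τ₀ * τ₁) * hU
      have hτ' : τ₁ - τ₀ ≠ 0 := sub_ne_zero.2 (Ne.symm hτ)
      have := (mul_eq_zero.1 key).resolve_left hτ'
      exact (mul_eq_zero.1 this).resolve_right (pow_ne_zero 2 hυ₀)
  · -- generic case: the two `X₀(3)`-coordinates `tᵢ = Δ/υᵢ²` are distinct
    have hυ₀2 : υ₀ ^ 2 ≠ 0 := pow_ne_zero 2 hυ₀
    have hυ₁2 : υ₁ ^ 2 ≠ 0 := pow_ne_zero 2 hυ₁
    have key₀ : (V.baseChange L).c₄ ^ 3 * υ₀ ^ 6 = τ₀ ^ 3 * (τ₀ ^ 3 - 24 * υ₀ ^ 2) ^ 3 := by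
      calc (V.baseChange L).c₄ ^ 3 * υ₀ ^ 6 = ((V.baseChange L).c₄ * υ₀ ^ 2) ^ 3 := by ring
        _ = (τ₀ * (τ₀ ^ 3 - 24 * υ₀ ^ 2)) ^ 3 := by rw [h2₀]
        _ = _ := by ring
    have key₁ : (V.baseChange L).c₄ ^ 3 * υ₁ ^ 6 = τ₁ ^ 3 * (τ₁ ^ 3 - 24 * υ₁ ^ 2) ^ 3 := by
      calc (V.baseChange L).c₄ ^ 3 * υ₁ ^ 6 = ((V.baseChange L).c₄ * υ₁ ^ 2) ^ 3 := by ring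
        _ = (τ₁ * (τ₁ ^ 3 - 24 * υ₁ ^ 2)) ^ 3 := by rw [h2₁]
        _ = _ := by ring
    have ht₀ := hauptmodul_algebra (c := (V.baseChange L).c₄) hυ₀ h1₀ key₀
    have ht₁ := hauptmodul_algebra (c := (V.baseChange L).c₄) hυ₁ h1₁ key₁
    obtain ⟨t₀, ht₀d⟩ : ∃ t : L, t = (V.baseChange L).Δ / υ₀ ^ 2 := ⟨_, rfl⟩
    obtain ⟨t₁, ht₁d⟩ : ∃ t : L, t = (V.baseChange L).Δ / υ₁ ^ 2 := ⟨_, rfl⟩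
    rw [← ht₀d] at ht₀
    rw [← ht₁d] at ht₁
    have htne : t₀ ≠ t₁ := by
      intro h
      apply hU
      rw [ht₀d, ht₁d, div_eq_div_iff hυ₀2 hυ₁2] at h
      exact (mul_right_injective₀ hΔL h).symm
    obtain ⟨hcA, hrel⟩ := pair_relations_of_roots hΔL htne ht₀ ht₁
    have hid := pair_hauptmodul_identity hcA hrel
    by_cases hB : t₀ * t₁ + 27 = 0
    · -- `B = −27`: then `A = −18` and `j = 1728`
      have hB' : t₀ * t₁ = -27 := by linear_combination hB
      have hA2 : (t₀ + t₁ + 18) ^ 2 = 0 := by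
        have : (-27 : L) * ((t₀ + t₁ + 18) ^ 2) = 0 := by
          rw [hB'] at hrel
          linear_combination hrel
        exact (mul_eq_zero.1 this).resolve_left (by norm_num)
      have hA : t₀ + t₁ = -18 := by
        have := pow_eq_zero_iff (n := 2) (by norm_num) |>.1 hA2
        linear_combination this
      right; left
      apply back1728
      rw [hcA, hA, hB']
      ring
    · -- the hauptmodul `u = 9(A+18)/(B+27)`, descended to `K`
      have hu := pair_hauptmodul_div hB hid
      right; right
      -- symmetric functions of the flex data, as elements of `K`
      set S₀ : K := 4 * (s ^ 3 - 3 * s * p) + V.b₂ * (s ^ 2 - 2 * p) + 2 * V.b₄ * s + 2 * V.b₆ with hS₀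
      set P₀ : K := 16 * p ^ 3 + 4 * V.b₂ * p ^ 2 * s + 8 * V.b₄ * p * (s ^ 2 - 2 * p)
        + 4 * V.b₆ * (s ^ 3 - 3 * s * p) + V.b₂ ^ 2 * p ^ 2 + 2 * V.b₂ * V.b₄ * s * p
        + V.b₂ * V.b₆ * (s ^ 2 - 2 * p) + 4 * V.b₄ ^ 2 * p + 2 * V.b₄ * V.b₆ * s + V.b₆ ^ 2 with hP₀
      have hS : υ₀ + υ₁ = algebraMap K L S₀ := by
        rw [hυ₀d, hυ₁d, hS₀]
        simp only [map_add, map_mul, map_sub, map_pow, map_ofNat, ← hs, ← hp, ← hb₂, ← hb₄, ← hb₆]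
        ring
      have hP : υ₀ * υ₁ = algebraMap K L P₀ := by
        rw [hυ₀d, hυ₁d, hP₀]
        simp only [map_add, map_mul, map_sub, map_pow, map_ofNat, ← hs, ← hp, ← hb₂, ← hb₄, ← hb₆]
        ring
      have hP0 : P₀ ≠ 0 := by
        intro h0
        rw [h0, map_zero] at hP
        rcases mul_eq_zero.1 hP with h | h
        · exact hυ₀ h
        · exact hυ₁ h
      have hPL : algebraMap K L P₀ ≠ 0 := (map_ne_zero_iff _ inj).2 hP0
      set A₀ : K := V.Δ * (S₀ ^ 2 - 2 * P₀) / P₀ ^ 2 with hA₀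
      set B₀ : K := V.Δ ^ 2 / P₀ ^ 2 with hB₀
      have hA : t₀ + t₁ = algebraMap K L A₀ := by
        rw [ht₀d, ht₁d, hA₀, map_div₀, map_mul, map_sub, map_pow, map_mul, map_pow, map_ofNat,
          ← hΔ', ← hS, ← hP, div_add_div _ _ hυ₀2 hυ₁2, div_eq_div_iff (mul_ne_zero hυ₀2 hυ₁2)
            (pow_ne_zero 2 (mul_ne_zero hυ₀ hυ₁))]
        ring
      have hBB : t₀ * t₁ = algebraMap K L B₀ := by
        rw [ht₀d, ht₁d, hB₀, map_div₀, map_pow, map_pow, ← hΔ', ← hP, div_mul_div_comm,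
          div_eq_div_iff (mul_ne_zero hυ₀2 hυ₁2) (pow_ne_zero 2 (mul_ne_zero hυ₀ hυ₁))]
        ring
      have hB0 : B₀ + 27 ≠ 0 := by
        intro h0
        apply hB
        rw [hBB, ← map_ofNat (algebraMap K L) 27, ← map_add, h0, map_zero]
      refine ⟨9 * (A₀ + 18) / (B₀ + 27), ?_⟩
      apply inj
      rw [hA, hBB, hc₄, hΔ'] at hu
      simp only [map_mul, map_pow, map_div₀, map_add, map_sub, map_ofNat, map_one]
      convert hu using 3

/-- **The `s3`-binder of the route's cruxes gives a `K`-point of `X_s⁺(3)` over `j(E)`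
(off `j ∈ {0, 1728}`).**  For a number field `K`, `E / 𝓞 K` with `Δ(E) ≠ 0`, and a framing `ρ̄` of
`E[3]` with image in `C_s⁺(3) = ⟨diag(1,2), antidiag(1,1)⟩` (VERBATIM the `s3`-disjunct of
`BoxBorelFive` / `RefinedLocusModular` / RECORD v5's `hNFw`): `c₄(E⊗K) = 0`, or
`c₄(E⊗K)³ = 1728 Δ(E⊗K)`, or `∃ u : K, c₄(E⊗K)³ · u³ = 27 (u+1)³ (u−3)³ · Δ(E⊗K)` — the level-`3`
conjunct of `hNFw`'s conclusion (`j = 27(u+1)³(u−3)³/u³`).  Proof: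
`exists_pair_roots_Ψ₃_of_splitCartanThree_framing` (p799791) and
`exists_XsplitThree_hauptmodul_of_pair_roots`.
[cite: FreitasLeHungSiksek2015, §2.2] [cite: SilvermanAEC2009, III.§7, Ex. 3.7] -/
theorem exists_XsplitThree_hauptmodul_of_splitCartanThree_framing (K : Type) [Field K] [NumberField K]
    (E : WeierstrassCurve (𝓞 K)) (hE : E.Δ ≠ 0)
    (h3 : ∃ ρ : Literature.NumberTheory.GaloisRepresentations.FramedGaloisRep K (ZMod 3) 2,
      (∃ e : (E.baseChange K).geomTorsion ((3 : ℕ) : ℤ) ≃+ (Fin 2 → ZMod 3),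
        ∀ (σ : Field.absoluteGaloisGroup K) (P : (E.baseChange K).geomTorsion ((3 : ℕ) : ℤ)),
          e (σ • P) = ((ρ σ : GL (Fin 2) (ZMod 3)) : Matrix (Fin 2) (Fin 2) (ZMod 3)) *ᵥ (e P)) ∧
      (∀ σ : Field.absoluteGaloisGroup K, (ρ σ : GL (Fin 2) (ZMod 3)) ∈ Subgroup.closure
        ({(⟨!![1, 0; 0, 2], !![1, 0; 0, 2], by decide, by decide⟩ : GL (Fin 2) (ZMod 3)),
          (⟨!![0, 1; 1, 0], !![0, 1; 1, 0], by decide, by decide⟩ : GL (Fin 2) (ZMod 3))} :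
          Set (GL (Fin 2) (ZMod 3))))) :
    (E.baseChange K).c₄ = 0 ∨ (E.baseChange K).c₄ ^ 3 = 1728 * (E.baseChange K).Δ ∨
      ∃ u : K, (E.baseChange K).c₄ ^ 3 * u ^ 3 = 27 * (u + 1) ^ 3 * (u - 3) ^ 3 * (E.baseChange K).Δ := by
  obtain ⟨x₁, x₂, hne, hx₁, hx₂, ⟨s, hs⟩, ⟨p, hp⟩⟩ :=
    exists_pair_roots_Ψ₃_of_splitCartanThree_framing K E h3
  have hΔK : (E.baseChange K).Δ ≠ 0 := by
    rw [WeierstrassCurve.baseChange, WeierstrassCurve.map_Δ]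
    exact (map_ne_zero_iff _ (FaithfulSMul.algebraMap_injective (𝓞 K) K)).2 hE
  exact exists_XsplitThree_hauptmodul_of_pair_roots (E.baseChange K) hΔK hne hx₁ hx₂ hs.symm hp.symm

end Summit.Langlands.Langlands.Theorems.SqrtFiveQuarticCovers

end
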